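import Mathlib
import HarnessLib
import Summits.Ventures.LatticeQCDFlow.Scoring.SplitChainFreshPairMoments

/-!
# THE TOUR VARIANCE IS THE ASYMPTOTIC VARIANCE — FOR EVERY MINORISING LAW:
# `ε · E_ν̂[Z_0²] = 2⟨f̄, g⟩_π − π(f̄²) = Var_π f + 2 Σ_{k≥1} C_f(k)`, `g` any bounded Poisson solution

HONEST FRAMING: exact (Metropolis-corrected) sampling algorithms for lattice gauge theory;
figures of merit are autocorrelation/cost numbers at stated couplings and volumes; no
continuum-physics claim.

Venture `LatticeQCDFlow` (cell pub-lqcd), topic `Scoring`; FANOUT row 8 (`s0-cpn-nemc`, GEN-17).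
NEW WORK of the cell, not a published result; no definition is introduced.  `Scoring/TourVariance.lean`
(GEN-16) identified the second moment of the centred tour sum of the split chain with the Green–Kubo
asymptotic variance when the minorising law is the invariant law itself (`κ(x, ·) ≥ ε π`).  This file
removes that restriction: for `κ(x, ·) ≥ ε ν` with `ν` ANY probability law (the situation of a
non-equilibrium / flow proposal minorised by its reference law, or of any small set argument),
`π` invariant, `0 < ε < 1`, `|f| ≤ C`, `f̄ = f − π(f)` and `Z_0 = ∑' u, 1{K_u = 0} f̄(X_u)` the centred sum
over the first tour of the fresh split chain from `ν ⊗ δ_true`: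
`ε · E[Z_0²] = 2 ∫ f̄ g dπ − ∫ f̄² dπ` with `g = Σ_d (1−ε)^d R^d f̄` the split-chain resolvent
(`Scoring/SplitResolventPoisson.lean`: a bounded solution of the POISSON EQUATION `g − K g = f̄`), hence
`= 2 ∫ f̄ h dπ − ∫ f̄² dπ` for EVERY bounded measurable Poisson solution `h`
(`Scoring/MinorisedGreenKubo.poisson_inner_eq_minorised`), hence, by Green–Kubo for a kernel minorised
by any law (`Scoring/MinorisedGreenKubo.greenKubo_hasSum_minorised`),
`= ∫ f̄² dπ + 2 Σ_{k≥1} ∫ f̄ · K^k f̄ dπ = Var_π f + 2 Σ_{k≥1} C_f(k)` — the number that the `τ_int`-based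
error bars of the row estimate.  Route: the double series of `Scoring/SplitChainFreshPairMoments.lean`,
a rearrangement of the triangular array `Σ_u Σ_{t<u} b(t, u−t) = Σ_t Σ_{d≥1} b(t, d)` (absolute
convergence from `|b(t,d)| ≤ (2C)²(1−ε)^{t+d}`), the resolvent tail `Σ_{d≥1} (1−ε)^d R^d f̄ = g − f̄`
inside the expectation, and Kac's formula `Σ_t E_ν̂[1{K_t=0} φ(X_t)] = π(φ)/ε` twice (`φ = f̄²` and
`φ = f̄ (g − f̄)`).  Printed counterpart NAMED ONLY: `σ²_f = E_ν̂[Z_1²]/E_ν̂[N_1] = 2⟨f̄, ĝ⟩_π − ⟨f̄, f̄⟩_π`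
(Nummelin 1984 §7.4; Meyn–Tweedie 1993 Thms 17.3.6, 17.4.4 and eq. (17.44); Glynn–Meyn 1996;
Mykland–Tierney–Yu 1995 eq. (4); Hobert–Jones–Presnell–Rosenthal 2002 §2) — nothing is cited as a fact.

## Content (`e = ε.toReal`; `0 < ε < 1`; `π` invariant; `|f| ≤ C` measurable; `f̄ = f − π(f)`)

* **`tsum_sum_range_rearrange`** — `Summable (u ↦ Σ_{t<u} b t (u−t))` and
  `∑' u, Σ_{t<u} b t (u−t) = ∑' t, ∑' d, b t (d+1)` whenever `|b t d| ≤ M r^{t+d}`, `0 ≤ r < 1`;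
* **`splitChain_fresh_sq_centredTourSum_eq_resolvent`** —
  `e · E_ν̂[Z_0²] = 2 ∫ f̄ · (Σ_d (1−e)^d (kop R)^[d] f̄) dπ − ∫ f̄² dπ`;
* **`splitChain_fresh_sq_centredTourSum_eq_poisson`** — `= 2 ∫ f̄ h dπ − ∫ f̄² dπ` for every bounded
  measurable `h` with `h − kop κ h = f̄`;
* **`splitChain_fresh_sq_centredTourSum_eq_greenKubo`** —
  `= ∫ f̄² dπ + 2 ∑' k, ∫ f̄ · (kop κ)^[k+1] f̄ dπ`  (THE TOUR VARIANCE IS THE ASYMPTOTIC VARIANCE).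

Reading (value-free): whatever minorising law certifies the sampler, the regenerative error bar of
`Scoring/RegenerativeEstimator*.lean` and the integrated-autocorrelation error bar measure the same
`σ²`.  NOT CLAIMED: the CLT; optimal constants in the regenerative certificates (they still use the
crude bound `E[Z_0²] ≤ (2C)²(2−ε)/ε²`); any `ε` of a concrete sampler.
-/

noncomputable section

namespace Summit.Ventures.LatticeQCDFlow.Scoring

open MeasureTheory ProbabilityTheory Filter Finset Preorder Literature.Probability.MarkovChains
open scoped ENNReal

/-! ### A rearrangement of triangular double series -/

section Rearrange

/-- **Rearrangement**: for `|b t d| ≤ M r^{t+d}` with `0 ≤ r < 1`, the row sums `Σ_{t<u} b t (u − t)`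
are summable in `u` and `∑' u, Σ_{t<u} b t (u − t) = ∑' t, ∑' d, b t (d + 1)`. -/
theorem tsum_sum_range_rearrange {b : ℕ → ℕ → ℝ} {M r : ℝ} (hr0 : 0 ≤ r) (hr1 : r < 1)
    (hb : ∀ t d, |b t d| ≤ M * r ^ (t + d)) :
    Summable (fun u => ∑ t ∈ Finset.range u, b t (u - t))
    ∧ ∑' u, ∑ t ∈ Finset.range u, b t (u - t) = ∑' t, ∑' d, b t (d + 1) := by
  have hM : 0 ≤ M := by
    have h := hb 0 0
    rw [Nat.add_zero, pow_zero, mul_one] at h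
    exact (abs_nonneg _).trans h
  have hrn : ‖r‖ < 1 := by rw [Real.norm_eq_abs, abs_of_nonneg hr0]; exact hr1
  have hrow_sum : Summable fun u : ℕ => (u : ℝ) * (M * r ^ u) :=
    ((hasSum_coe_mul_geometric_of_norm_lt_one hrn).summable.mul_left M).congr fun u => by ring
  -- the triangular array as a function on `ℕ × ℕ`
  set G : ℕ → ℕ → ℝ := fun u t => if t < u then b t (u - t) else 0 with hG
  have hGb : ∀ u t, |G u t| ≤ (if t < u then M * r ^ u else 0) := by
    intro u t
    simp only [hG]
    split_ifs with h
    · have := hb t (u - t)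
      rwa [show t + (u - t) = u by omega] at this
    · rw [abs_zero]
  have hrow : ∀ u : ℕ, ∑' t, (if t < u then M * r ^ u else 0) = u * (M * r ^ u) := by
    intro u
    rw [tsum_eq_sum (s := Finset.range u) fun t ht => by
      rw [if_neg (fun h => ht (Finset.mem_range.2 h))]]
    rw [Finset.sum_congr rfl fun t ht => by rw [if_pos (Finset.mem_range.1 ht)],
      Finset.sum_const, Finset.card_range, nsmul_eq_mul]
  -- the majorant is summable on the product
  have hHsum : Summable fun p : ℕ × ℕ => (if p.2 < p.1 then M * r ^ p.1 else 0) := by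
    refine (summable_prod_of_nonneg fun p => ?_).2 ⟨fun u => ?_, ?_⟩
    · dsimp only
      split_ifs
      · exact mul_nonneg hM (pow_nonneg hr0 _)
      · exact le_rfl
    · refine summable_of_ne_finset_zero (s := Finset.range u) fun t ht => ?_
      dsimp only
      rw [if_neg (fun h => ht (Finset.mem_range.2 h))]
    · simp only [hrow]
      exact hrow_sum
  have hGsum : Summable fun p : ℕ × ℕ => G p.1 p.2 :=
    Summable.of_norm_bounded hHsum fun p => by rw [Real.norm_eq_abs]; exact hGb p.1 p.2
  have hGsum' : Summable (Function.uncurry fun t u => G u t) :=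
    ((Equiv.prodComm ℕ ℕ).summable_iff.2 hGsum).congr fun p => rfl
  have hGrow : ∀ u, Summable fun t => G u t := fun u =>
    summable_of_ne_finset_zero (s := Finset.range u) fun t ht => by
      simp only [hG]; rw [if_neg (fun h => ht (Finset.mem_range.2 h))]
  have hGcol : ∀ t, Summable fun u => G u t := fun t =>
    Summable.of_norm_bounded ((summable_geometric_of_lt_one hr0 hr1).mul_left M) fun u => by
      rw [Real.norm_eq_abs]
      refine (hGb u t).trans ?_
      split_ifs
      · exact le_rfl
      · exact mul_nonneg hM (pow_nonneg hr0 u)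
  -- LHS as an iterated sum of `G`
  have hL : ∀ u, ∑ t ∈ Finset.range u, b t (u - t) = ∑' t, G u t := by
    intro u
    rw [tsum_eq_sum (s := Finset.range u) fun t ht => by
      simp only [hG]; rw [if_neg (fun h => ht (Finset.mem_range.2 h))]]
    exact Finset.sum_congr rfl fun t ht => by simp only [hG]; rw [if_pos (Finset.mem_range.1 ht)]
  -- columns of `G` are the shifted rows of `b`
  have hR : ∀ t, ∑' u, G u t = ∑' d, b t (d + 1) := by
    intro t
    rw [← (hGcol t).sum_add_tsum_nat_add (t + 1), Finset.sum_eq_zero fun u hu => by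
      simp only [hG]; rw [if_neg (by have := Finset.mem_range.1 hu; omega)], zero_add]
    refine tsum_congr fun d => ?_
    simp only [hG]
    rw [if_pos (by omega), show d + (t + 1) - t = d + 1 by omega]
  refine ⟨?_, ?_⟩
  · refine Summable.of_norm_bounded hrow_sum fun u => ?_
    rw [Real.norm_eq_abs, hL u, ← hrow u]
    calc |∑' t, G u t| = |∑ t ∈ Finset.range u, G u t| := by
          rw [tsum_eq_sum (s := Finset.range u) fun t ht => by
            simp only [hG]; rw [if_neg (fun h => ht (Finset.mem_range.2 h))]]
      _ ≤ ∑ t ∈ Finset.range u, |G u t| := Finset.abs_sum_le_sum_abs _ _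
      _ ≤ ∑ t ∈ Finset.range u, (if t < u then M * r ^ u else 0) := Finset.sum_le_sum fun t _ => hGb u t
      _ = ∑' t, (if t < u then M * r ^ u else 0) := (tsum_eq_sum (s := Finset.range u) fun t ht => by
          rw [if_neg (fun h => ht (Finset.mem_range.2 h))]).symm
  · simp_rw [hL]
    rw [hGsum'.tsum_comm' hGcol hGrow]
    exact tsum_congr hR

end Rearrange

/-! ### The tour variance for a general minorising law -/

section Variance

variable {Ω : Type*} [MeasurableSpace Ω]
  {κ : Kernel Ω Ω} [IsMarkovKernel κ] {ν : Measure Ω} [IsProbabilityMeasure ν] {ε : ℝ≥0∞}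
  {hmin : ∀ x {B : Set Ω}, MeasurableSet B → ε * ν B ≤ κ x B}
  (κs : Kernel (Ω × Bool) (Ω × Bool)) [IsMarkovKernel κs]

/-- **`ε · E_ν̂[Z_0²] = 2 ∫ f̄ g dπ − ∫ f̄² dπ`** with `g = Σ_d (1 − e)^d (kop R)^[d] f̄` the split-chain
resolvent (a bounded Poisson solution): `π` invariant, `κ(x, ·) ≥ ε ν` for any probability law `ν`,
`0 < ε < 1`, `|f| ≤ C` measurable, `f̄ = f − π(f)`, fresh split chain from `ν ⊗ δ_true`. -/
theorem splitChain_fresh_sq_centredTourSum_eq_resolvent {π : Measure Ω} [IsProbabilityMeasure π]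
    (hπ : Kernel.Invariant κ π) (hε0 : 0 < ε) (hε : ε < 1)
    (hκs : ∀ p, κs p = (ε • ν).map (fun y : Ω => (y, true))
      + ((1 - ε) • Doeblin.residualKernel κ ν ε hmin p.1).map (fun y : Ω => (y, false)))
    {f : Ω → ℝ} (hf : Measurable f) {C : ℝ} (hC : ∀ x, |f x| ≤ C) :
    ε.toReal * ∫ x, (∑' u, (if (∑ s ∈ Finset.range u, (if (x (s + 1)).2 then (1 : ℕ) else 0)) = 0
        then (1 : ℝ) else 0) * (f (x u).1 - ∫ z, f z ∂π)) ^ 2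
        ∂(Kernel.trajMeasure (X := fun _ : ℕ => Ω × Bool) (ν.map (fun y : Ω => (y, true)))
          (fun n : ℕ => κs.comap (fun h : (i : ↥(Finset.Iic n)) → Ω × Bool =>
            h ⟨n, Finset.mem_Iic.2 le_rfl⟩) (measurable_pi_apply _)))
      = 2 * ∫ y, (f y - ∫ z, f z ∂π) * (∑' d, (1 - ε.toReal) ^ d
          * (kop (Doeblin.residualKernel κ ν ε hmin))^[d] (fun y => f y - ∫ z, f z ∂π) y) ∂π
        - ∫ y, (f y - ∫ z, f z ∂π) ^ 2 ∂π := by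
  haveI hνt : IsProbabilityMeasure (ν.map (fun y : Ω => (y, true))) :=
    Measure.isProbabilityMeasure_map (measurable_tagCoin true).aemeasurable
  haveI := Doeblin.isMarkovKernel_residualKernel (κ := κ) (ν := ν) (hmin := hmin) hε
  obtain ⟨hfb, hCfb, -⟩ := centred_observable_bounds π hf hC
  set P := Kernel.trajMeasure (X := fun _ : ℕ => Ω × Bool) (ν.map (fun y : Ω => (y, true)))
      (fun n : ℕ => κs.comap (fun h : (i : ↥(Finset.Iic n)) → Ω × Bool =>
        h ⟨n, Finset.mem_Iic.2 le_rfl⟩) (measurable_pi_apply _)) with hP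
  set c := ∫ z, f z ∂π with hc
  set r : ℝ := 1 - ε.toReal with hrdef
  obtain ⟨-, hr0, he1⟩ := one_sub_toReal_eq_of_lt_one (ε := ε) hε
  rw [← hrdef] at hr0
  have he0 : 0 < ε.toReal := ENNReal.toReal_pos hε0.ne' (ne_top_of_lt hε)
  have hr1 : r < 1 := by rw [hrdef]; linarith
  -- the centred observable and the resolvent
  have hC0 : 0 ≤ C := (abs_nonneg _).trans (hC (Classical.choice (nonempty_of_isProbabilityMeasure π)))
  have hRd := fun d => iterate_kop_bounded_measurable (Doeblin.residualKernel κ ν ε hmin) hfb hCfb d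
  obtain ⟨hgm, hgb⟩ := resolvent_bounded_measurable (κ := κ) (ν := ν) (hmin := hmin) hε0 hε hfb hCfb
  have hterm := fun d y => resolvent_term_abs_le (κ := κ) (ν := ν) (hmin := hmin) hε hfb hCfb d y
  -- the indicator `1{K_t = 0}`: in `[0, 1]`, measurable, mean `r^t`
  have hind : ∀ (t : ℕ) (x : ℕ → Ω × Bool), 0 ≤ (if (∑ s ∈ Finset.range t,
      (if (x (s + 1)).2 then (1 : ℕ) else 0)) = 0 then (1 : ℝ) else 0)
      ∧ (if (∑ s ∈ Finset.range t, (if (x (s + 1)).2 then (1 : ℕ) else 0)) = 0 then (1 : ℝ) else 0) ≤ 1 :=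
    fun t x => by constructor <;> split_ifs <;> norm_num
  have hTint : ∀ t : ℕ, ∫ x, (if (∑ s ∈ Finset.range t, (if (x (s + 1)).2 then (1 : ℕ) else 0)) = 0
      then (1 : ℝ) else 0) ∂P = r ^ t := fun t => by
    simp_rw [headCount_eq_zero_indicator]
    rw [hP]; exact splitChain_fresh_tailsRun κs (κ := κ) (ν := ν) (hmin := hmin) hε hκs t
  have hfbt : ∀ t : ℕ, Measurable fun x : ℕ → Ω × Bool => f (x t).1 - c := fun t =>
    hfb.comp (measurable_fst.comp (measurable_pi_apply t))
  -- the array `b t d = r^d E[1{K_t=0} f̄(X_t) (R^d f̄)(X_t)]` and its bound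
  set b : ℕ → ℕ → ℝ := fun t d => r ^ d * ∫ x, (if (∑ s ∈ Finset.range t,
      (if (x (s + 1)).2 then (1 : ℕ) else 0)) = 0 then (1 : ℝ) else 0) * ((f (x t).1 - c)
      * (kop (Doeblin.residualKernel κ ν ε hmin))^[d] (fun y => f y - c) (x t).1) ∂P with hbdef
  have hbb : ∀ t d, |b t d| ≤ (2 * C) ^ 2 * r ^ (t + d) := by
    intro t d
    obtain ⟨hmd, hbd⟩ := hRd d
    have hI : |∫ x, (if (∑ s ∈ Finset.range t, (if (x (s + 1)).2 then (1 : ℕ) else 0)) = 0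
        then (1 : ℝ) else 0) * ((f (x t).1 - c)
        * (kop (Doeblin.residualKernel κ ν ε hmin))^[d] (fun y => f y - c) (x t).1) ∂P|
        ≤ (2 * C) ^ 2 * r ^ t := by
      rw [← hTint t, ← integral_const_mul, ← Real.norm_eq_abs]
      refine norm_integral_le_of_norm_le ((integrable_of_bounded P (measurable_headCountIndicator t 0)
        (C := 1) fun x => by rw [abs_of_nonneg (hind t x).1]; exact (hind t x).2).const_mul _)
        (ae_of_all _ fun x => ?_)
      rw [Real.norm_eq_abs, abs_mul, abs_of_nonneg (hind t x).1, mul_comm]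
      refine mul_le_mul_of_nonneg_right ?_ (hind t x).1
      rw [abs_mul]
      calc _ ≤ (2 * C) * (2 * C) := mul_le_mul (hCfb _) (hbd _) (abs_nonneg _) (by positivity)
        _ = (2 * C) ^ 2 := by ring
    simp only [hbdef]
    rw [abs_mul, abs_of_nonneg (pow_nonneg hr0 d), pow_add]
    calc r ^ d * _ ≤ r ^ d * ((2 * C) ^ 2 * r ^ t) := mul_le_mul_of_nonneg_left hI (pow_nonneg hr0 d)
      _ = (2 * C) ^ 2 * (r ^ t * r ^ d) := by ring
  obtain ⟨hbsum, hrearr⟩ := tsum_sum_range_rearrange hr0 hr1 hbb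
  -- the diagonal: Kac with `φ = f̄²`
  have hdiag := splitChain_fresh_occupation_hasSum κs (κ := κ) (ν := ν) (hmin := hmin) hπ hε0 hε hκs
    (φ := fun y => (f y - c) ^ 2) (hfb.pow_const 2) (Cφ := (2 * C) ^ 2)
    (fun y => by rw [abs_pow]; exact pow_le_pow_left₀ (abs_nonneg _) (hCfb y) 2)
  rw [← hP] at hdiag
  -- the off-diagonal columns: `Σ_d b t (d+1) = E[1{K_t=0} f̄(X_t) (g − f̄)(X_t)]`
  have hcol : ∀ t : ℕ, ∑' d, b t (d + 1) = ∫ x, (if (∑ s ∈ Finset.range t,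
      (if (x (s + 1)).2 then (1 : ℕ) else 0)) = 0 then (1 : ℝ) else 0) * ((f (x t).1 - c)
      * ((∑' d, (1 - ε.toReal) ^ d * (kop (Doeblin.residualKernel κ ν ε hmin))^[d]
          (fun y => f y - c) (x t).1) - (f (x t).1 - c))) ∂P := by
    intro t
    have hF : ∀ d : ℕ, Integrable (fun x : ℕ → Ω × Bool => (if (∑ s ∈ Finset.range t,
        (if (x (s + 1)).2 then (1 : ℕ) else 0)) = 0 then (1 : ℝ) else 0) * ((f (x t).1 - c)
        * (r ^ (d + 1) * (kop (Doeblin.residualKernel κ ν ε hmin))^[d + 1] (fun y => f y - c) (x t).1)))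
        P := fun d => by
      obtain ⟨hmd, hbd⟩ := hRd (d + 1)
      refine integrable_of_bounded P ((measurable_headCountIndicator t 0).mul ((hfbt t).mul
        ((hmd.comp (measurable_fst.comp (measurable_pi_apply t))).const_mul _)))
        (C := 1 * ((2 * C) * ((2 * C) * r ^ (d + 1)))) fun x => ?_
      rw [abs_mul, abs_of_nonneg (hind t x).1, abs_mul]
      refine mul_le_mul (hind t x).2 (mul_le_mul (hCfb _) ?_ (abs_nonneg _) (by positivity))
        (by positivity) zero_le_one
      rw [hrdef]; exact hterm (d + 1) _
    have hFn : Summable fun d : ℕ => ∫ x, ‖(if (∑ s ∈ Finset.range t,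
        (if (x (s + 1)).2 then (1 : ℕ) else 0)) = 0 then (1 : ℝ) else 0) * ((f (x t).1 - c)
        * (r ^ (d + 1) * (kop (Doeblin.residualKernel κ ν ε hmin))^[d + 1] (fun y => f y - c) (x t).1))‖
        ∂P := by
      refine Summable.of_nonneg_of_le (fun d => integral_nonneg fun x => norm_nonneg _) (fun d => ?_)
        (((summable_geometric_of_lt_one hr0 hr1).mul_left ((2 * C) * (2 * C) * r)))
      obtain ⟨hmd, hbd⟩ := hRd (d + 1)
      calc _ ≤ ∫ x, (2 * C) * ((2 * C) * r ^ (d + 1)) ∂P := by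
            refine integral_mono (hF d).norm (integrable_const _) fun x => ?_
            rw [Real.norm_eq_abs, abs_mul, abs_of_nonneg (hind t x).1, abs_mul]
            calc _ ≤ 1 * (|f (x t).1 - c| * |r ^ (d + 1)
                  * (kop (Doeblin.residualKernel κ ν ε hmin))^[d + 1] (fun y => f y - c) (x t).1|) :=
                  mul_le_mul_of_nonneg_right (hind t x).2 (by positivity)
              _ ≤ 1 * ((2 * C) * ((2 * C) * r ^ (d + 1))) := by
                  refine mul_le_mul_of_nonneg_left (mul_le_mul (hCfb _) ?_ (abs_nonneg _) (by positivity))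
                    zero_le_one
                  rw [hrdef]; exact hterm (d + 1) _
              _ = _ := one_mul _
        _ = (2 * C) * (2 * C) * r * r ^ d := by rw [integral_const, probReal_univ, one_smul, pow_succ]; ring
    have hb' : ∀ d : ℕ, b t (d + 1) = ∫ x, (if (∑ s ∈ Finset.range t,
        (if (x (s + 1)).2 then (1 : ℕ) else 0)) = 0 then (1 : ℝ) else 0) * ((f (x t).1 - c)
        * (r ^ (d + 1) * (kop (Doeblin.residualKernel κ ν ε hmin))^[d + 1] (fun y => f y - c) (x t).1))
        ∂P := fun d => by
      simp only [hbdef]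
      rw [← integral_const_mul]
      exact integral_congr_ae (ae_of_all _ fun x => by ring)
    simp_rw [hb']
    rw [integral_tsum_of_summable_integral_norm hF hFn]
    refine integral_congr_ae (ae_of_all _ fun x => ?_)
    beta_reduce
    rw [tsum_mul_left, tsum_mul_left, hrdef,
      resolvent_tail_eq (κ := κ) (ν := ν) (hmin := hmin) hε0 hε hfb hCfb (x t).1]
  -- Kac with `φ = f̄ (g − f̄)`
  have hφm : Measurable fun y => (f y - c) * ((∑' d, (1 - ε.toReal) ^ d
      * (kop (Doeblin.residualKernel κ ν ε hmin))^[d] (fun y => f y - c) y) - (f y - c)) :=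
    hfb.mul (hgm.sub hfb)
  have hφb : ∀ y, |(f y - c) * ((∑' d, (1 - ε.toReal) ^ d
      * (kop (Doeblin.residualKernel κ ν ε hmin))^[d] (fun y => f y - c) y) - (f y - c))|
      ≤ (2 * C) * (2 * C / ε.toReal + 2 * C) := fun y => by
    rw [abs_mul]
    exact mul_le_mul (hCfb y) ((abs_sub _ _).trans (add_le_add (hgb y) (hCfb y))) (abs_nonneg _)
      (by positivity)
  have hoff := splitChain_fresh_occupation_hasSum κs (κ := κ) (ν := ν) (hmin := hmin) hπ hε0 hε hκs
    hφm hφb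
  rw [← hP] at hoff
  -- assemble
  have hseries := splitChain_fresh_sq_centredTourSum_series κs (κ := κ) (ν := ν) (hmin := hmin)
    (π := π) hε0 hε hκs hf hC
  rw [← hP, ← hc] at hseries
  have hsplit : ∑' u, ((∫ x, (if (∑ s ∈ Finset.range u, (if (x (s + 1)).2 then (1 : ℕ) else 0)) = 0
      then (1 : ℝ) else 0) * (f (x u).1 - c) ^ 2 ∂P) + 2 * ∑ t ∈ Finset.range u, b t (u - t))
      = (∫ y, (f y - c) ^ 2 ∂π) / ε.toReal + 2 * ∑' u, ∑ t ∈ Finset.range u, b t (u - t) := by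
    rw [Summable.tsum_add hdiag.summable (hbsum.mul_left 2), hdiag.tsum_eq, tsum_mul_left]
  have hin1 : Integrable (fun y => (f y - c) * (∑' d, (1 - ε.toReal) ^ d
      * (kop (Doeblin.residualKernel κ ν ε hmin))^[d] (fun y => f y - c) y)) π :=
    integrable_of_bounded π (hfb.mul hgm) (C := (2 * C) * (2 * C / ε.toReal)) fun y => by
      rw [abs_mul]; exact mul_le_mul (hCfb y) (hgb y) (abs_nonneg _) (by positivity)
  have hin2 : Integrable (fun y => (f y - c) ^ 2) π :=
    integrable_of_bounded π (hfb.pow_const 2) (C := (2 * C) ^ 2) fun y => by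
      rw [abs_pow]; exact pow_le_pow_left₀ (abs_nonneg _) (hCfb y) 2
  have hφint : ∫ y, (f y - c) * ((∑' d, (1 - ε.toReal) ^ d
      * (kop (Doeblin.residualKernel κ ν ε hmin))^[d] (fun y => f y - c) y) - (f y - c)) ∂π
      = (∫ y, (f y - c) * (∑' d, (1 - ε.toReal) ^ d
          * (kop (Doeblin.residualKernel κ ν ε hmin))^[d] (fun y => f y - c) y) ∂π)
        - ∫ y, (f y - c) ^ 2 ∂π := by
    rw [← integral_sub hin1 hin2]
    exact integral_congr_ae (ae_of_all _ fun y => by ring)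
  have hmain : ∫ x, (∑' u, (if (∑ s ∈ Finset.range u, (if (x (s + 1)).2 then (1 : ℕ) else 0)) = 0
      then (1 : ℝ) else 0) * (f (x u).1 - c)) ^ 2 ∂P
      = (∫ y, (f y - c) ^ 2 ∂π) / ε.toReal
        + 2 * (((∫ y, (f y - c) * (∑' d, (1 - ε.toReal) ^ d
          * (kop (Doeblin.residualKernel κ ν ε hmin))^[d] (fun y => f y - c) y) ∂π)
          - ∫ y, (f y - c) ^ 2 ∂π) / ε.toReal) := by
    rw [hseries, hsplit, hrearr, tsum_congr hcol, hoff.tsum_eq, hφint]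
  rw [hmain]
  field_simp
  ring

/-- **`ε · E_ν̂[Z_0²] = 2 ∫ f̄ h dπ − ∫ f̄² dπ` FOR EVERY BOUNDED MEASURABLE POISSON SOLUTION `h`**
(`h − kop κ h = f̄`): the tour second moment is the Poisson-equation form of the asymptotic variance. -/
theorem splitChain_fresh_sq_centredTourSum_eq_poisson {π : Measure Ω} [IsProbabilityMeasure π]
    (hπ : Kernel.Invariant κ π) (hε0 : 0 < ε) (hε : ε < 1)
    (hκs : ∀ p, κs p = (ε • ν).map (fun y : Ω => (y, true))
      + ((1 - ε) • Doeblin.residualKernel κ ν ε hmin p.1).map (fun y : Ω => (y, false)))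
    {f : Ω → ℝ} (hf : Measurable f) {C : ℝ} (hC : ∀ x, |f x| ≤ C)
    {h : Ω → ℝ} (hh : Measurable h) {Ch : ℝ} (hCh : ∀ x, |h x| ≤ Ch)
    (hpois : ∀ x, h x - kop κ h x = f x - ∫ z, f z ∂π) :
    ε.toReal * ∫ x, (∑' u, (if (∑ s ∈ Finset.range u, (if (x (s + 1)).2 then (1 : ℕ) else 0)) = 0
        then (1 : ℝ) else 0) * (f (x u).1 - ∫ z, f z ∂π)) ^ 2
        ∂(Kernel.trajMeasure (X := fun _ : ℕ => Ω × Bool) (ν.map (fun y : Ω => (y, true)))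
          (fun n : ℕ => κs.comap (fun h : (i : ↥(Finset.Iic n)) → Ω × Bool =>
            h ⟨n, Finset.mem_Iic.2 le_rfl⟩) (measurable_pi_apply _)))
      = 2 * ∫ y, (f y - ∫ z, f z ∂π) * h y ∂π - ∫ y, (f y - ∫ z, f z ∂π) ^ 2 ∂π := by
  obtain ⟨hfb, hCfb, hfb0⟩ := centred_observable_bounds π hf hC
  obtain ⟨hgm, hgb⟩ := resolvent_bounded_measurable (κ := κ) (ν := ν) (hmin := hmin) hε0 hε hfb hCfb
  rw [splitChain_fresh_sq_centredTourSum_eq_resolvent κs (κ := κ) (ν := ν) (hmin := hmin) hπ hε0 hε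
    hκs hf hC, poisson_inner_eq_minorised (κ := κ) (ν := ν) hπ hmin hε0 hε hfb hCfb hfb0 hgm hgb
    (fun x => resolvent_poisson (κ := κ) (ν := ν) (hmin := hmin) hπ hε0 hε hfb hCfb hfb0 x) hh hCh hpois]

/-- **THE TOUR VARIANCE IS THE ASYMPTOTIC VARIANCE, FOR EVERY MINORISING LAW.**  `π` invariant,
`κ(x, ·) ≥ ε ν` with `ν` any probability law, `0 < ε < 1`, `|f| ≤ C` measurable, `f̄ = f − π(f)`,
`Z_0 = ∑' u, 1{K_u = 0} f̄(X_u)` under the fresh split chain from `ν ⊗ δ_true`: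
`e · E[Z_0²] = ∫ f̄² dπ + 2 ∑' k, ∫ f̄ · (kop κ)^[k+1] f̄ dπ` (`= Var_π f + 2 Σ_{k≥1} C_f(k)`). -/
theorem splitChain_fresh_sq_centredTourSum_eq_greenKubo {π : Measure Ω} [IsProbabilityMeasure π]
    (hπ : Kernel.Invariant κ π) (hε0 : 0 < ε) (hε : ε < 1)
    (hκs : ∀ p, κs p = (ε • ν).map (fun y : Ω => (y, true))
      + ((1 - ε) • Doeblin.residualKernel κ ν ε hmin p.1).map (fun y : Ω => (y, false)))
    {f : Ω → ℝ} (hf : Measurable f) {C : ℝ} (hC : ∀ x, |f x| ≤ C) :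
    ε.toReal * ∫ x, (∑' u, (if (∑ s ∈ Finset.range u, (if (x (s + 1)).2 then (1 : ℕ) else 0)) = 0
        then (1 : ℝ) else 0) * (f (x u).1 - ∫ z, f z ∂π)) ^ 2
        ∂(Kernel.trajMeasure (X := fun _ : ℕ => Ω × Bool) (ν.map (fun y : Ω => (y, true)))
          (fun n : ℕ => κs.comap (fun h : (i : ↥(Finset.Iic n)) → Ω × Bool =>
            h ⟨n, Finset.mem_Iic.2 le_rfl⟩) (measurable_pi_apply _)))
      = (∫ y, (f y - ∫ z, f z ∂π) ^ 2 ∂π)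
        + 2 * ∑' k, ∫ y, (f y - ∫ z, f z ∂π)
          * (kop κ)^[k + 1] (fun y => f y - ∫ z, f z ∂π) y ∂π := by
  obtain ⟨hfb, hCfb, hfb0⟩ := centred_observable_bounds π hf hC
  have hGK := greenKubo_hasSum_resolvent (κ := κ) (ν := ν) hπ hmin hε0 hε hfb hCfb hfb0
  have h1 := (hasSum_nat_add_iff' (f := fun t => autocov κ π (fun y => f y - ∫ z, f z ∂π) t) 1).2 hGK
  rw [Finset.sum_range_one, autocov_zero] at h1
  unfold autocov at h1
  rw [splitChain_fresh_sq_centredTourSum_eq_resolvent κs (κ := κ) (ν := ν) (hmin := hmin) hπ hε0 hε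
    hκs hf hC, h1.tsum_eq]
  ring

end Variance

end Summit.Ventures.LatticeQCDFlow.Scoring

end
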